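import Summits.QuantumFields.QCD.Theses.PauliWegnerSea
import Summits.QuantumFields.QCD.Theorems.MobilityGap.Negative.LowerPin
import Literature.MathematicalPhysics.QuantumFieldTheory.QCDGoldstoneBound

/-!
# `ChiralOneScaleTrajectory` (crux stmt-QuantumFields-17512) — negative-side support: along subsequences the body
# minus the pin is hereditary, the pin is so only in its Goldstone form

Definition-free extract of the standing disprover's `Cruxes/ChiralOneScaleTrajectory/Disproof.lean` §5
(cdisprove cycle 1), in the vocabulary of `Theorems/MobilityGap/Negative/LowerPin.lean` and of
`Literature/…/QCDGoldstoneBound.lean` (`QCDRegularisation.restrict`, `HasGoldstoneBound`).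

* `bodyMinusPin_restrict` — both scalings and the per-mass package ((i) ∧ one-scale ∧ (iii) ∧ (iv)) pass from
  `reg` to every reindexing `reg.restrict φ hφ`, `φ → ∞` (all are `Tendsto` / `∀ᶠ k` clauses);
* `isChiralAtZero_restrict_iff` — the typed pin of the reindexed regularisation, unfolded: violations of the gap
  inequality of `reg` at the indices `φ t` for infinitely many `t` — data about `reg` ALONG `φ`, which the pin of
  `reg` (violations frequently in `k`) does not supply;
* `body_restrict_of_hasGoldstoneBound` — with the EVENTUAL Goldstone lower bound in place of the pin the whole body
  is hereditary.  Consequence for provers of the crux: a witness produced by a diagonal / subsequence construction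
  from approximate witnesses must carry `HasGoldstoneBound` (eventual, one channel), not merely `IsChiralAtZero`.
-/

noncomputable section

namespace Summit.QuantumFields.QCD.Theorems.ChiralOneScaleTrajectory.Negative

open scoped BigOperators Topology
open MeasureTheory Filter Set
open Literature.MathematicalPhysics.QuantumFieldTheory Literature.MathematicalPhysics.QuantumLattice
  Literature.Probability.LatticeModels
open Summit.QuantumFields.QCD.Theorems.MobilityGapNegative

variable {Nf : ℕ}

/-- **The body minus the pin is hereditary under reindexing** along any `φ → ∞`. -/
theorem bodyMinusPin_restrict (reg : QCDRegularisation Nf) (φ : ℕ → ℕ) (hφ : Tendsto φ atTop atTop)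
    (h : reg.HasMassScaling ∧ (reg.scheme 0 0 0).HasAsymptoticScaling ∧
      ∀ m : Fin Nf → ℝ, (∀ f, 0 < m f) → ClauseI reg m ∧
        (∀ q : ℕ, ∃ K₀ s : ℝ, 0 < s ∧ s < 1 ∧ ∀ᶠ k in atTop, ∃ ℓ₀ : ℕ, 1 ≤ ℓ₀ ∧ ℓ₀ ≤ reg.L k ∧
          (ℓ₀ : ℝ) * reg.a k ≤ K₀ * (1 + |Real.log (reg.a k)|) ∧ ∀ S : ℕ, reg.L k ≤ S →
            ∀ (f : Fin Nf) (v : Site 4), v ∈ box 4 S → ‖v‖ = (ℓ₀ : ℝ) →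
              (ℓ₀ : ℝ) ^ q * (1 + |reg.β k|) ^ q * fm Nf (reg.β k) (bare reg m k) S f v s ≤ 1) ∧
        Lower reg m ∧ Sign reg m) :
    (reg.restrict φ hφ).HasMassScaling ∧ ((reg.restrict φ hφ).scheme 0 0 0).HasAsymptoticScaling ∧
      ∀ m : Fin Nf → ℝ, (∀ f, 0 < m f) → ClauseI (reg.restrict φ hφ) m ∧
        (∀ q : ℕ, ∃ K₀ s : ℝ, 0 < s ∧ s < 1 ∧ ∀ᶠ k in atTop, ∃ ℓ₀ : ℕ, 1 ≤ ℓ₀ ∧ ℓ₀ ≤ (reg.restrict φ hφ).L k ∧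
          (ℓ₀ : ℝ) * (reg.restrict φ hφ).a k ≤ K₀ * (1 + |Real.log ((reg.restrict φ hφ).a k)|) ∧
            ∀ S : ℕ, (reg.restrict φ hφ).L k ≤ S → ∀ (f : Fin Nf) (v : Site 4), v ∈ box 4 S → ‖v‖ = (ℓ₀ : ℝ) →
              (ℓ₀ : ℝ) ^ q * (1 + |(reg.restrict φ hφ).β k|) ^ q *
                fm Nf ((reg.restrict φ hφ).β k) (bare (reg.restrict φ hφ) m k) S f v s ≤ 1) ∧
        Lower (reg.restrict φ hφ) m ∧ Sign (reg.restrict φ hφ) m := by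
  obtain ⟨hMS, hAS, hP⟩ := h
  refine ⟨?_, ?_, fun m hm => ?_⟩
  · obtain ⟨c, hc, ht⟩ := hMS
    exact ⟨c, hc, ht.comp hφ⟩
  · obtain ⟨Λ, hΛ, ht⟩ := hAS
    exact ⟨Λ, hΛ, ht.comp hφ⟩
  · obtain ⟨hI, hO, ⟨s, c₀, C₁, p, hs, hs1, hc₀, hL⟩, hIV⟩ := hP m hm
    refine ⟨fun f => hφ.eventually (hI f), fun q => ?_, ⟨s, c₀, C₁, p, hs, hs1, hc₀, hφ.eventually hL⟩,
      hφ.eventually hIV⟩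
    obtain ⟨K₀, s', hs', hs1', hk⟩ := hO q
    exact ⟨K₀, s', hs', hs1', hφ.eventually hk⟩

/-- **The typed pin of the reindexed regularisation, unfolded**: for every rate some positive tuple and some pair
`(A, B)` violate the gap inequality of `reg` at indices `φ t` for INFINITELY MANY `t`, for every constant. -/
theorem isChiralAtZero_restrict_iff (reg : QCDRegularisation Nf) (φ : ℕ → ℕ) (hφ : Tendsto φ atTop atTop) :
    (reg.restrict φ hφ).IsChiralAtZero ↔ ∀ ε > (0 : ℝ), ∃ m : Fin Nf → ℝ, (∀ f, 0 < m f) ∧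
      ∃ (R R' : ℕ) (A : QCDLatticeObservable Nf R) (B : QCDLatticeObservable Nf R'), ∀ C : ℝ,
        ∃ᶠ t in atTop, ∃ S : ℕ, reg.L (φ t) ≤ S ∧ ∃ n : ℕ, n ≤ S ∧
          C * Real.exp (-(ε * (reg.a (φ t) * n))) <
            ‖qcdLatticeConnectedCorr (reg.β (φ t)) (2 * S + 1)
              (fun fl => reg.mcrit (φ t) + reg.a (φ t) * m fl / reg.Zm (φ t)) A B n‖ := by
  unfold QCDRegularisation.IsChiralAtZero QCDScheme.HasLatticeMassGap
  simp only [not_forall, not_exists, Filter.not_eventually, not_le, exists_prop, gt_iff_lt]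
  rfl

/-- **With the Goldstone form of the pin the whole body is hereditary**: both scalings, `IsChiralAtZero` and the
package at every positive tuple hold for `reg.restrict φ hφ` whenever `reg` has the body minus the pin and the
EVENTUAL Goldstone bound (`HasGoldstoneBound.isChiralAtZero_restrict`). -/
theorem body_restrict_of_hasGoldstoneBound (reg : QCDRegularisation Nf) (φ : ℕ → ℕ)
    (hφ : Tendsto φ atTop atTop)
    (h : reg.HasMassScaling ∧ (reg.scheme 0 0 0).HasAsymptoticScaling ∧
      ∀ m : Fin Nf → ℝ, (∀ f, 0 < m f) → ClauseI reg m ∧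
        (∀ q : ℕ, ∃ K₀ s : ℝ, 0 < s ∧ s < 1 ∧ ∀ᶠ k in atTop, ∃ ℓ₀ : ℕ, 1 ≤ ℓ₀ ∧ ℓ₀ ≤ reg.L k ∧
          (ℓ₀ : ℝ) * reg.a k ≤ K₀ * (1 + |Real.log (reg.a k)|) ∧ ∀ S : ℕ, reg.L k ≤ S →
            ∀ (f : Fin Nf) (v : Site 4), v ∈ box 4 S → ‖v‖ = (ℓ₀ : ℝ) →
              (ℓ₀ : ℝ) ^ q * (1 + |reg.β k|) ^ q * fm Nf (reg.β k) (bare reg m k) S f v s ≤ 1) ∧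
        Lower reg m ∧ Sign reg m)
    (hG : reg.HasGoldstoneBound) :
    (reg.restrict φ hφ).HasMassScaling ∧ (reg.restrict φ hφ).IsChiralAtZero ∧
      ((reg.restrict φ hφ).scheme 0 0 0).HasAsymptoticScaling ∧
      ∀ m : Fin Nf → ℝ, (∀ f, 0 < m f) → ClauseI (reg.restrict φ hφ) m ∧
        (∀ q : ℕ, ∃ K₀ s : ℝ, 0 < s ∧ s < 1 ∧ ∀ᶠ k in atTop, ∃ ℓ₀ : ℕ, 1 ≤ ℓ₀ ∧ ℓ₀ ≤ (reg.restrict φ hφ).L k ∧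
          (ℓ₀ : ℝ) * (reg.restrict φ hφ).a k ≤ K₀ * (1 + |Real.log ((reg.restrict φ hφ).a k)|) ∧
            ∀ S : ℕ, (reg.restrict φ hφ).L k ≤ S → ∀ (f : Fin Nf) (v : Site 4), v ∈ box 4 S → ‖v‖ = (ℓ₀ : ℝ) →
              (ℓ₀ : ℝ) ^ q * (1 + |(reg.restrict φ hφ).β k|) ^ q *
                fm Nf ((reg.restrict φ hφ).β k) (bare (reg.restrict φ hφ) m k) S f v s ≤ 1) ∧
        Lower (reg.restrict φ hφ) m ∧ Sign (reg.restrict φ hφ) m := by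
  obtain ⟨hMS, hAS, hP⟩ := bodyMinusPin_restrict reg φ hφ h
  exact ⟨hMS, hG.isChiralAtZero_restrict φ hφ, hAS, hP⟩

end Summit.QuantumFields.QCD.Theorems.ChiralOneScaleTrajectory.Negative

end
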